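import Summits.Langlands.Langlands.Theorems.QuarterDeficit1951IcosahedralSupplyOfDeRham1951
import Literature.NumberTheory.PAdicHodge.BdRFiniteImage

/-!
# Route `QuarterDeficit1951` (Langlands) — crux `IcosahedralSupply` (stmt-Langlands-15899): SKELETON

Line `Sketch` (lead prover-line-stmt-Langlands-15899-0; continuation leads c1, c2 — 2026-08-17).
The even icosahedral supply of conductor `1951` is built EXPLICITLY and is LANDED:

* `doudMooreField`, `stub_icosahedralEmbedding`, `stub_tateTwistLift`, `stub_conductor`,
  `stub_frobeniusReadout`, `stub_irreducible`, `artinSupply` — the Doud–Moore `A₅` quintic, Tate's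
  lifting with ramification control, conductor `1951`, order-`5` determinant, fingerprint,
  irreducibility (files `Theorems/QuarterDeficit1951IcosahedralSupply*.lean`);
* `IcosahedralSupply_away` — THE CRUX VERBATIM for every prime `ℓ ≥ 17`, `ℓ ≠ 1951`;
* `IcosahedralSupply_of_finiteImage_isDeRhamFramed_1951` (c1) — the crux from "finite-image local
  representations at `v = (1951)` are de Rham for the pinned datum";
* NEW (c2, Literature): `PeriodRingData.isAdmissible_of_isOpen` (Hilbert-90 period matrix over a
  finite Galois `L/F`: potentially trivial representations are `B`-admissible for every period ring
  receiving `F̄` equivariantly, file `GaloisRepresentations/PotentiallyTrivialAdmissible`) and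
  `PstWeilDeligneData.isDeRhamFramed_of_finite_range_of_bdR` (finite-image representations are de
  Rham for every datum whose period ring is the GENUINE `B_dR(F) = bdRPeriodRingData`, file
  `PAdicHodge/BdRFiniteImage`) — the mathematical content of c1's stub, PROVED for Fontaine's ring.

## Status (continuation lead c2, 2026-08-17)

ONE registered stub is open, reshaped by c2 to the exact as-typed residue:
`stub_pst_periodRing_eq_bdR_1951` — at the place `v` of `ℚ` above `1951`, the period ring of the
PINNED datum `fontainePstAdicCompletion v 1951 hv = Classical.epsilon (IsFontaineDatum _)` IS
`bdRPeriodRingData` (Fontaine's `B_dR(ℚ_v)`, now constructed in the tree).  This is precisely the D1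
half of the "Upgrade path" of `Literature/NumberTheory/PAdicHodge/FontaineDpst.lean` (replace the
body of `fontainePst` by the construction): for the `ε`-term it is neither provable (ε ranges over
ALL data with clauses (F1)–(F8), e.g. exotic Tannakian sub-period-rings of `B_dR`) nor refutable
(ε may be the genuine datum).  Given the stub, the crux follows from the landed theorems
(`IcosahedralSupply_of` below = the landed `IcosahedralSupply_of_pst_periodRing_eq_bdR`).  The
zero-cost route-level repair is unchanged: restate `17 ≤ ℓ → ℓ ≠ 1951 → …` (= `IcosahedralSupply_away`;
the route's `closes` uses `ℓ = 17` only).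
-/

set_option linter.dupNamespace false

noncomputable section

open scoped NumberField MatrixGroups
open Field IsDedekindDomain ValuativeRel
open Literature.NumberTheory.GaloisRepresentations Literature.NumberTheory.PAdicHodge

namespace Summit.Langlands.Langlands.Theorems.QuarterDeficit1951

/-- **Stub (the one open obligation; = the D1 Upgrade path of `fontainePst`, INDEPENDENT OF THE
TREE AS TYPED).**  At the place `v` of `ℚ` above `1951`, the period ring of the pinned `p`-adic
Hodge datum `fontainePstAdicCompletion v 1951 hv` (for its own `ℚ_1951`-algebra structure on `ℚ_v`)
is Fontaine's `B_dR(ℚ_v)`, the accepted construction `bdRPeriodRingData` (`B_dR^{Γ_F} = F` by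
Ax–Sen–Tate).  The instance hypotheses are the accepted facts `LocalField.charZero_adicCompletion`,
`not_isUnit_natCast_integerC`, `isAdicComplete_integerC_natCast`, taken as arguments so that the
signature is closed. [cite: FontaineAsterisque223III, Exp. II §1.5 and Exp. III §3] -/
theorem stub_pst_periodRing_eq_bdR_1951 [Fact (Nat.Prime 1951)]
    (v : HeightOneSpectrum (𝓞 ℚ)) (hv : ((1951 : ℕ) : 𝓞 ℚ) ∈ v.asIdeal)
    [CharZero (v.adicCompletion ℚ)] [Fact (¬ IsUnit ((1951 : ℕ) : integerC (v.adicCompletion ℚ)))]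
    [IsAdicComplete (Ideal.span {((1951 : ℕ) : integerC (v.adicCompletion ℚ))})
      (integerC (v.adicCompletion ℚ))] :
    (fontainePstAdicCompletion v 1951 hv).𝔅 =
      @bdRPeriodRingData (v.adicCompletion ℚ) _ _ _ _ _ 1951 _ _ _
        (LocalField.valuation_adicCompletion_natCast_lt_one v 1951 hv)
        (fontainePstAdicCompletion v 1951 hv).algebra := by
  sorry

/-- **The crux, by name** (item stmt-Langlands-15899): `IcosahedralSupply_away` at `ℓ ≠ 1951`, and at
`ℓ = 1951` the Doud–Moore witness `artinSupply` over `ℚ̄_1951`, whose local representation at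
`v = (1951)` has finite image and is therefore de Rham for the GENUINE `B_dR(ℚ_v)`
(`PstWeilDeligneData.isDeRhamFramed_of_finite_range_of_bdR`), which the one open stub identifies
with the pinned datum's period ring.  This is the landed reduction
`IcosahedralSupply_of_pst_periodRing_eq_bdR` (file `…OfPstBdR`) with the stub fed in; the proof is
repeated inline so that the skeleton elaborates against already-built modules.
[cite: DoudMoore2006, §2 and §4] [cite: FontaineAsterisque223III, Exp. III §1.5 and §3] -/
theorem IcosahedralSupply_of :
    Summit.Langlands.Langlands.Theses.QuarterDeficit1951.IcosahedralSupply :=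
  IcosahedralSupply_of_finiteImage_isDeRhamFramed_1951 fun v hv _ r hr => by
    haveI := LocalField.charZero_adicCompletion v
    haveI : Fact (¬ IsUnit ((1951 : ℕ) : integerC (v.adicCompletion ℚ))) :=
      ⟨not_isUnit_natCast_integerC (LocalField.valuation_adicCompletion_natCast_lt_one v 1951 hv)⟩
    haveI := isAdicComplete_integerC_natCast (F := v.adicCompletion ℚ) (p := 1951)
      (LocalField.valuation_adicCompletion_natCast_lt_one v 1951 hv)
    exact PstWeilDeligneData.isDeRhamFramed_of_finite_range_of_bdR _ _
      (stub_pst_periodRing_eq_bdR_1951 v hv) r hr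

end Summit.Langlands.Langlands.Theorems.QuarterDeficit1951

end
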